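import Mathlib
import HarnessLib
import Summits.Langlands.Langlands.Theses.ParityBlindBianchi
import Summits.Langlands.Langlands.Theorems.ParityBlindBianchiResidualBianchiDoorMod2TwoAdicModel
import Literature.NumberTheory.GaloisRepresentations.FramedRepTwist
import Literature.NumberTheory.Automorphic.StrongArtinGL2

/-!
# What the route `ParityBlindBianchi` actually consumes of R′ = `ArtinWeightRealisationLevel`
(stmt-Langlands-15111) — helper file (`--supports`), line `Sketch`, continuation lead c15

Two kernel-checked facts for the planner, complementing the sector reductions of
`…OddBaseChangeSector` (c14), `…OddTwistSector` and `…DescentSector` (c15):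

* `route_instance_mem_descent_sector` — in the deciding theorem `ParityBlindBianchi.closes`, R′
  is applied only to the `2`-adic models `σ` of `ρ|_{Γ_K}` supplied by E1′
  (`ι((σ g)ᵢⱼ) = (ρ|_{Γ_K}(g))ᵢⱼ`, `ρ : Γ_ℚ → GL₂(ℂ)` an Artin representation); every such `σ` is
  `(ρ'|_{Γ_K}) ⊗ 1` with `ρ' = ι⁻¹ ∘ ρ` of finite image, i.e. it lies in the DESCENT-UP-TO-TWIST
  sector `∃ ρ' ψ, Finite ρ'.range ∧ Finite ψ.range ∧ (ρ'|_{Γ_K}) ⊗ ψ = σ`;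
* `target_of_descent_sector` — hence the route's chain reaches its TARGET `EvenIcosahedralStrongArtin`
  (and then the summit through `EvenArtinJunction`, exactly as `closes`) with R′ WEAKENED to that
  sector, all other hypotheses verbatim: `E1′ → E2′ → R′|{descent sector} → D′ → Target`;
* `target_of_even_route_sector` — and indeed with R′ weakened to the literal instance: `p = 2`,
  `σ` a `2`-adic model of `ρ|_{Γ_K}` for `ρ` irreducible, projectively `A₅` and EVEN.

Together with `…DescentSector` (`artinWeightRealisationLevel_descent_sector_of_target`: the
descent sector of R′ follows from the route's TARGET `EvenIcosahedralStrongArtin` modulo LT, KW,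
Booker, Arthur–Clozel 4.2 (a), JL) this pins the crux down: modulo theorems in print and the other
route items, the part of R′ the route needs is EQUIVALENT to the target, and the rest of R′ (the
non-descending icosahedral `σ` over `K`) is never used.  The only way R′ can be easier than the
target is through its `p`-adic automorphy hypothesis — non-regular-weight classicality over a
field with a complex place (`Literature.Barriers.Langlands.NonRegularWeightBarrier`, Calegari 2023
§12), which no landed result uses.
-/

noncomputable section

open scoped BigOperators Topology Classical Matrix NumberField MatrixGroups
open Literature.NumberTheory.Automorphic Literature.NumberTheory.GaloisRepresentations
  IsDedekindDomain NumberField Filter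

-- `Summit.Langlands.Langlands.…`: summit = sub-problem name (D-0017 nested layout), not a typo.
set_option linter.dupNamespace false

namespace Summit.Langlands.Langlands.Theorems.ArtinWeightRealisationLevel

/-- **The instance of R′ consumed by the route lies in the descent sector.**  In the deciding
theorem `ParityBlindBianchi.closes`, R′ is applied to the `2`-adic model `σ` of `ρ|_{Γ_K}` supplied
by E1′: `ι((σ g)ᵢⱼ) = (ρ|_{Γ_K}(g))ᵢⱼ` entrywise for an Artin representation `ρ : Γ_ℚ → GL₂(ℂ)`.
Any such `σ` is `(ρ'|_{Γ_K}) ⊗ 1` for the finite-image transport `ρ' = ι⁻¹ ∘ ρ : Γ_ℚ → GL₂(ℚ̄_p)`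
(`exists_map_ringEquiv`; `finite_range_toMonoidHom`), i.e. it lies in the descent-up-to-twist
sector (registered stub). [folklore] -/
theorem route_instance_mem_descent_sector : ∀ (K : Type) [Field K] [NumberField K] (p : ℕ) [Fact p.Prime] (ι : PadicAlgCl p ≃+* ℂ) (ρ : Literature.NumberTheory.GaloisRepresentations.FramedArtinRep ℚ 2) (σ : Literature.NumberTheory.GaloisRepresentations.FramedGaloisRep K (PadicAlgCl p) 2), (∀ (g : Field.absoluteGaloisGroup K) (i j : Fin 2), ι ((σ g).val i j) = ((Literature.NumberTheory.GaloisRepresentations.FramedGaloisRep.restrictField K ρ) g).val i j) → (∃ (ρ : Literature.NumberTheory.GaloisRepresentations.FramedGaloisRep ℚ (PadicAlgCl p) 2) (ψ : Field.absoluteGaloisGroup K →ₜ* (PadicAlgCl p)ˣ), Finite ρ.toMonoidHom.range ∧ Finite ψ.toMonoidHom.range ∧ Literature.NumberTheory.GaloisRepresentations.FramedRep.twist (ρ.restrictField K) ψ = σ) := by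
  intro K _ _ p _ ι ρ σ hmodel
  haveI : Finite ρ.toMonoidHom.range := finite_range_toMonoidHom ρ
  obtain ⟨ρ', hρ', hfin', -⟩ := ResidualBianchiDoorMod2.exists_map_ringEquiv ρ ι.symm
  refine ⟨ρ', 1, hfin', ?_, ?_⟩
  · have h : ((1 : Field.absoluteGaloisGroup K →ₜ* (PadicAlgCl p)ˣ).toMonoidHom.range :
        Set (PadicAlgCl p)ˣ) ⊆ {1} := by
      rintro _ ⟨g, rfl⟩
      exact Set.mem_singleton_iff.mpr rfl
    exact Set.Finite.to_subtype ((Set.finite_singleton _).subset h)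
  · rw [FramedRep.twist_one]
    refine ContinuousMonoidHom.ext fun g => Units.ext (Matrix.ext fun i j => ?_)
    have h1 : ρ'.toMonoidHom (absGaloisRestrict ℚ K g) =
        (Matrix.GeneralLinearGroup.map ι.symm.toRingHom) (ρ (absGaloisRestrict ℚ K g)) := by
      rw [hρ']; rfl
    have h2 : ((ρ'.restrictField K) g).val i j = ι.symm ((ρ (absGaloisRestrict ℚ K g)).val i j) := by
      change (ρ'.toMonoidHom (absGaloisRestrict ℚ K g)).val i j = _
      rw [h1]; rfl
    rw [h2, ← FramedGaloisRep.restrictField_apply, ← hmodel g i j, RingEquiv.symm_apply_apply]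

/-- **The route reaches its target with R′ weakened to its descent-up-to-twist sector** (registered
stub): verbatim the deciding theorem `ParityBlindBianchi.closes` up to the junction (Steinitz
`ι : ℚ̄₂ ≃+* ℂ`, E1′, E2′ at `p = 2`, D′), with the full crux `ArtinWeightRealisationLevel` replaced by its restriction
to the `σ = (ρ'|_{Γ_K}) ⊗ ψ` (`ρ'`, `ψ` of finite image); the sector membership of E1′'s `σ` is
`route_instance_mem_descent_sector`. [folklore] -/
theorem target_of_descent_sector : Summit.Langlands.Langlands.Theses.ParityBlindBianchi.ResidualBianchiDoorLevel → Summit.Langlands.Langlands.Theses.ParityBlindBianchi.TwoAdicBianchiProModularityLevel → (∀ (K : Type) [Field K] [NumberField K], NumberField.IsTotallyComplex K → Module.finrank ℚ K = 2 → ∀ (p : ℕ) [Fact p.Prime] (ι : PadicAlgCl p ≃+* ℂ) (σ : Literature.NumberTheory.GaloisRepresentations.FramedGaloisRep K (PadicAlgCl p) 2), Finite σ.toMonoidHom.range → σ.toGaloisRep.IsIrreducible → (∃ (ρ : Literature.NumberTheory.GaloisRepresentations.FramedGaloisRep ℚ (PadicAlgCl p) 2) (ψ : Field.absoluteGaloisGroup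 K →ₜ* (PadicAlgCl p)ˣ), Finite ρ.toMonoidHom.range ∧ Finite ψ.toMonoidHom.range ∧ Literature.NumberTheory.GaloisRepresentations.FramedRep.twist (ρ.restrictField K) ψ = σ) → ∀ S₀ : Finset ℕ, p ∈ S₀ → (∃ (U : Subgroup (GL (Fin 2) (IsDedekindDomain.FiniteAdeleRing (NumberField.RingOfIntegers K) K))) (ϖ : ∀ v : IsDedekindDomain.HeightOneSpectrum (NumberField.RingOfIntegers K), (v.adicCompletion K)ˣ) (a : {v : IsDedekindDomain.HeightOneSpectrum (NumberField.RingOfIntegers K) // ∀ ℓ ∈ S₀, ((ℓ : ℕ) : NumberField.RingOfIntegers K) ∉ v.asIdeal} → ℕ → (Valued.v (R := PadicAlgCl p)).valuationSubring), IsOpen (U : Set (GL (Fin 2) (IsDedekindDomain.FiniteAdeleRing (NumberField.RingOfIntegers K) K))) ∧ U ≤ Literature.NumberTheory.Automorphic.glFiniteIntegralLevel 2 K ∧ (∀ g ∈ Literature.NumberTheory.Automorphic.glFiniteIntegralLevel 2 K, (∀ v : IsDedekindDomain.HeightOneSpectrum (NumberField.RingOfIntegers K), ¬ (∀ ℓ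 ∈ S₀, ((ℓ : ℕ) : NumberField.RingOfIntegers K) ∉ v.asIdeal) → ∀ i j : Fin 2, ((g : Matrix (Fin 2) (Fin 2) (IsDedekindDomain.FiniteAdeleRing (NumberField.RingOfIntegers K) K)) i j) v = (1 : Matrix (Fin 2) (Fin 2) (v.adicCompletion K)) i j) → g ∈ U) ∧ (∀ v : IsDedekindDomain.HeightOneSpectrum (NumberField.RingOfIntegers K), Valued.v ((ϖ v : (v.adicCompletion K)ˣ) : v.adicCompletion K) = WithZero.exp (-1 : ℤ)) ∧ Literature.NumberTheory.Automorphic.IsHeckePoint (Matrix.GeneralLinearGroup.map (n := Fin 2) (algebraMap K (IsDedekindDomain.FiniteAdeleRing (NumberField.RingOfIntegers K) K))) (Literature.NumberTheory.Automorphic.LevelTower.ofSeq U (fun r : ℕ => (Literature.NumberTheory.Automorphic.principalCongruenceLevel 2 K (Ideal.span {((p : ℕ) : NumberField.RingOfIntegers K)} ^ r)).map (Literature.NumberTheory.Automorphic.GLn.sndHom 2 K))) ((p : ℕ) : (Valued.v (R := PadicAlgCl p)).valuationSubring) (fun j : {v : IsDedekindDomain.HeightOneSpectrum (NumberField.RingOfIntegers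 K) // ∀ ℓ ∈ S₀, ((ℓ : ℕ) : NumberField.RingOfIntegers K) ∉ v.asIdeal} × Fin 2 => Literature.NumberTheory.Automorphic.GLn.sndHom 2 K (Literature.NumberTheory.Automorphic.heckeDiagAt 2 K j.1.1 (ϖ j.1.1) (j.2.val + 1))) (fun j => a j.1 (j.2.val + 1)) ∧ ∀ (v : IsDedekindDomain.HeightOneSpectrum (NumberField.RingOfIntegers K)) (hv : ∀ ℓ ∈ S₀, ((ℓ : ℕ) : NumberField.RingOfIntegers K) ∉ v.asIdeal), σ.IsHeckeAssociatedAt v (fun i : ℕ => if i = 0 then (1 : PadicAlgCl p) else ((a ⟨v, hv⟩ i : (Valued.v (R := PadicAlgCl p)).valuationSubring) : PadicAlgCl p))) → ∃ (hcpt : Literature.NumberTheory.Automorphic.isCompact_glFiniteIntegralLevel 2 K) (π : Literature.NumberTheory.Automorphic.CuspidalAutomorphicRepData 2 K hcpt), ∀ w : IsDedekindDomain.HeightOneSpectrum (NumberField.RingOfIntegers K), (∀ ℓ ∈ S₀, ((ℓ : ℕ) : NumberField.RingOfIntegers K) ∉ w.asIdeal) → Summit.Langlands.SatakeFrobCompatibleAt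 ι π.1 σ w) → Summit.Langlands.Langlands.Theses.ParityBlindBianchi.IcosahedralDescentLevel → Summit.Langlands.Langlands.Theses.ParityBlindBianchi.EvenIcosahedralStrongArtin := by
  intro hE1 hE2 hR hD ρ hirr hA5 _heven
  -- an abstract field isomorphism ℚ̄₂ ≃+* ℂ (Steinitz), as in `closes`
  have hQ2 : Cardinal.mk ℚ_[2] = Cardinal.continuum := by
    apply le_antisymm
    · change Cardinal.mk (Quotient (CauSeq.equiv : Setoid (CauSeq ℚ (padicNorm 2)))) ≤ Cardinal.continuum
      refine (Cardinal.mk_quotient_le (s := (CauSeq.equiv : Setoid (CauSeq ℚ (padicNorm 2))))).trans ?_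
      refine (Cardinal.mk_subtype_le _).trans_eq ?_
      rw [← Cardinal.power_def, Cardinal.mk_nat, Cardinal.mkRat, Cardinal.aleph0_power_aleph0]
    · exact continuum_le_cardinal_of_nontriviallyNormedField ℚ_[2]
  have hC2 : Cardinal.mk (PadicAlgCl 2) = Cardinal.continuum := by
    apply le_antisymm
    · refine (Algebra.IsAlgebraic.cardinalMk_le_max ℚ_[2] (PadicAlgCl 2)).trans ?_
      rw [hQ2, max_eq_left Cardinal.aleph0_le_continuum]
    · rw [← hQ2]
      exact Cardinal.mk_le_of_injective (algebraMap ℚ_[2] (PadicAlgCl 2)).injective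
  obtain ⟨ι⟩ : Nonempty (PadicAlgCl 2 ≃+* ℂ) := by
    refine IsAlgClosed.ringEquiv_of_equiv_of_charZero ?_
      (Cardinal.eq.1 (by rw [hC2, Cardinal.mk_complex]))
    rw [hC2]
    exact Cardinal.aleph0_lt_continuum
  -- E1′: the uniform bad set S₀ ∋ 2 and, per field K, the residually automorphic 2-adic model σ
  obtain ⟨S₀, h2, hK⟩ := hE1 ι ρ hirr hA5
  -- D′ reduces the target to uniform (off S₀) compatibility over every 2-split imaginary quadratic K
  refine hD ι ρ hirr hA5 ⟨S₀, ?_⟩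
  intro K _ _ htc hdeg hsplit
  obtain ⟨σ, hmodel, hfin, hirrσ, hA5σ, hcpt, π₀, hRA, hgood⟩ := hK K htc hdeg hsplit
  -- E2′ (2-adic pro-modularity at level S₀) feeds R′|descent-sector (σ is in the sector)
  obtain ⟨hcpt', π, hπ⟩ := hR K htc hdeg 2 ι σ hfin hirrσ
    (route_instance_mem_descent_sector K 2 ι ρ σ hmodel) S₀ h2
    (hE2 K htc hdeg hsplit ι σ hfin hirrσ hA5σ S₀ h2 ⟨hcpt, π₀, hRA, hgood⟩)
  exact ⟨σ, hcpt', π, hmodel, hπ⟩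

/-- **The route reaches its target with R′ weakened to the literal instance it consumes**
(registered stub):
`p = 2` and `σ` a `2`-adic model (`ι((σ g)ᵢⱼ) = (ρ|_{Γ_K}(g))ᵢⱼ`) of `ρ|_{Γ_K}` for some
`ρ : Γ_ℚ → GL₂(ℂ)` irreducible, projectively `A₅` and EVEN (`det ρ(c) = 1`).  The evenness of the
target's `ρ`, discarded by `closes`, is threaded through here. [folklore] -/
theorem target_of_even_route_sector : Summit.Langlands.Langlands.Theses.ParityBlindBianchi.ResidualBianchiDoorLevel → Summit.Langlands.Langlands.Theses.ParityBlindBianchi.TwoAdicBianchiProModularityLevel → (∀ (K : Type) [Field K] [NumberField K], NumberField.IsTotallyComplex K → Module.finrank ℚ K = 2 → ∀ (ι : PadicAlgCl 2 ≃+* ℂ) (σ : Literature.NumberTheory.GaloisRepresentations.FramedGaloisRep K (PadicAlgCl 2) 2), Finite σ.toMonoidHom.range → σ.toGaloisRep.IsIrreducible → (∃ ρ : Literature.NumberTheory.GaloisRepresentations.FramedArtinRep ℚ 2, ρ.toGaloisRep.IsIrreducible ∧ Nonempty ((Matrix.ProjGenLinGroup.mk.comp ρ.toMonoidHom).range ≃*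 alternatingGroup (Fin 5)) ∧ (∀ (φ : ℚ →+* ℝ) (c : Field.absoluteGaloisGroup ℚ), Literature.NumberTheory.GaloisRepresentations.IsComplexConjugation φ c → Matrix.GeneralLinearGroup.det (ρ c) = 1) ∧ ∀ (g : Field.absoluteGaloisGroup K) (i j : Fin 2), ι ((σ g).val i j) = ((Literature.NumberTheory.GaloisRepresentations.FramedGaloisRep.restrictField K ρ) g).val i j) → ∀ S₀ : Finset ℕ, 2 ∈ S₀ → (∃ (U : Subgroup (GL (Fin 2) (IsDedekindDomain.FiniteAdeleRing (NumberField.RingOfIntegers K) K))) (ϖ : ∀ v : IsDedekindDomain.HeightOneSpectrum (NumberField.RingOfIntegers K), (v.adicCompletion K)ˣ) (a : {v : IsDedekindDomain.HeightOneSpectrum (NumberField.RingOfIntegers K) // ∀ ℓ ∈ S₀, ((ℓ : ℕ) : NumberField.RingOfIntegers K) ∉ v.asIdeal} → ℕ → (Valued.v (R := PadicAlgCl 2)).valuationSubring), IsOpen (U : Set (GL (Fin 2) (IsDedekindDomain.FiniteAdeleRing (NumberField.RingOfIntegers K) K))) ∧ U ≤ Literature.NumberTheory.Automorphic.glFiniteIntegralLevel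 2 K ∧ (∀ g ∈ Literature.NumberTheory.Automorphic.glFiniteIntegralLevel 2 K, (∀ v : IsDedekindDomain.HeightOneSpectrum (NumberField.RingOfIntegers K), ¬ (∀ ℓ ∈ S₀, ((ℓ : ℕ) : NumberField.RingOfIntegers K) ∉ v.asIdeal) → ∀ i j : Fin 2, ((g : Matrix (Fin 2) (Fin 2) (IsDedekindDomain.FiniteAdeleRing (NumberField.RingOfIntegers K) K)) i j) v = (1 : Matrix (Fin 2) (Fin 2) (v.adicCompletion K)) i j) → g ∈ U) ∧ (∀ v : IsDedekindDomain.HeightOneSpectrum (NumberField.RingOfIntegers K), Valued.v ((ϖ v : (v.adicCompletion K)ˣ) : v.adicCompletion K) = WithZero.exp (-1 : ℤ)) ∧ Literature.NumberTheory.Automorphic.IsHeckePoint (Matrix.GeneralLinearGroup.map (n := Fin 2) (algebraMap K (IsDedekindDomain.FiniteAdeleRing (NumberField.RingOfIntegers K) K))) (Literature.NumberTheory.Automorphic.LevelTower.ofSeq U (fun r : ℕ => (Literature.NumberTheory.Automorphic.principalCongruenceLevel 2 K (Ideal.span {((2 : ℕ) : NumberField.RingOfIntegers K)} ^ r)).map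 (Literature.NumberTheory.Automorphic.GLn.sndHom 2 K))) ((2 : ℕ) : (Valued.v (R := PadicAlgCl 2)).valuationSubring) (fun j : {v : IsDedekindDomain.HeightOneSpectrum (NumberField.RingOfIntegers K) // ∀ ℓ ∈ S₀, ((ℓ : ℕ) : NumberField.RingOfIntegers K) ∉ v.asIdeal} × Fin 2 => Literature.NumberTheory.Automorphic.GLn.sndHom 2 K (Literature.NumberTheory.Automorphic.heckeDiagAt 2 K j.1.1 (ϖ j.1.1) (j.2.val + 1))) (fun j => a j.1 (j.2.val + 1)) ∧ ∀ (v : IsDedekindDomain.HeightOneSpectrum (NumberField.RingOfIntegers K)) (hv : ∀ ℓ ∈ S₀, ((ℓ : ℕ) : NumberField.RingOfIntegers K) ∉ v.asIdeal), σ.IsHeckeAssociatedAt v (fun i : ℕ => if i = 0 then (1 : PadicAlgCl 2) else ((a ⟨v, hv⟩ i : (Valued.v (R := PadicAlgCl 2)).valuationSubring) : PadicAlgCl 2))) → ∃ (hcpt : Literature.NumberTheory.Automorphic.isCompact_glFiniteIntegralLevel 2 K) (π : Literature.NumberTheory.Automorphic.CuspidalAutomorphicRepData 2 K hcpt), ∀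 w : IsDedekindDomain.HeightOneSpectrum (NumberField.RingOfIntegers K), (∀ ℓ ∈ S₀, ((ℓ : ℕ) : NumberField.RingOfIntegers K) ∉ w.asIdeal) → Summit.Langlands.SatakeFrobCompatibleAt ι π.1 σ w) → Summit.Langlands.Langlands.Theses.ParityBlindBianchi.IcosahedralDescentLevel → Summit.Langlands.Langlands.Theses.ParityBlindBianchi.EvenIcosahedralStrongArtin := by
  intro hE1 hE2 hR hD ρ hirr hA5 heven
  have hQ2 : Cardinal.mk ℚ_[2] = Cardinal.continuum := by
    apply le_antisymm
    · change Cardinal.mk (Quotient (CauSeq.equiv : Setoid (CauSeq ℚ (padicNorm 2)))) ≤ Cardinal.continuum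
      refine (Cardinal.mk_quotient_le (s := (CauSeq.equiv : Setoid (CauSeq ℚ (padicNorm 2))))).trans ?_
      refine (Cardinal.mk_subtype_le _).trans_eq ?_
      rw [← Cardinal.power_def, Cardinal.mk_nat, Cardinal.mkRat, Cardinal.aleph0_power_aleph0]
    · exact continuum_le_cardinal_of_nontriviallyNormedField ℚ_[2]
  have hC2 : Cardinal.mk (PadicAlgCl 2) = Cardinal.continuum := by
    apply le_antisymm
    · refine (Algebra.IsAlgebraic.cardinalMk_le_max ℚ_[2] (PadicAlgCl 2)).trans ?_
      rw [hQ2, max_eq_left Cardinal.aleph0_le_continuum]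
    · rw [← hQ2]
      exact Cardinal.mk_le_of_injective (algebraMap ℚ_[2] (PadicAlgCl 2)).injective
  obtain ⟨ι⟩ : Nonempty (PadicAlgCl 2 ≃+* ℂ) := by
    refine IsAlgClosed.ringEquiv_of_equiv_of_charZero ?_
      (Cardinal.eq.1 (by rw [hC2, Cardinal.mk_complex]))
    rw [hC2]
    exact Cardinal.aleph0_lt_continuum
  obtain ⟨S₀, h2, hK⟩ := hE1 ι ρ hirr hA5
  refine hD ι ρ hirr hA5 ⟨S₀, ?_⟩
  intro K _ _ htc hdeg hsplit
  obtain ⟨σ, hmodel, hfin, hirrσ, hA5σ, hcpt, π₀, hRA, hgood⟩ := hK K htc hdeg hsplit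
  obtain ⟨hcpt', π, hπ⟩ := hR K htc hdeg ι σ hfin hirrσ ⟨ρ, hirr, hA5, heven, hmodel⟩ S₀ h2
    (hE2 K htc hdeg hsplit ι σ hfin hirrσ hA5σ S₀ h2 ⟨hcpt, π₀, hRA, hgood⟩)
  exact ⟨σ, hcpt', π, hmodel, hπ⟩

end Summit.Langlands.Langlands.Theorems.ArtinWeightRealisationLevel

end
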